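import Summits.CriticalPhenomena.PercolationContinuityZ3.Theorems.PercNearOneGluingNoHeavyLowerTailSunflowerMultiPetal
import Summits.CriticalPhenomena.PercolationContinuityZ3.Theorems.PercNearOneGluingNoHeavyLowerTailSunflowerTracePartition
import HarnessLib
import HarnessLib.Audit

/-!
# `NoHeavyLowerTail` (crux stmt-CriticalPhenomena-4575), abstract sunflower cubic, `k` petals: the MODULE (gadget-substitution) identity
# for glued partition sums, `ZK = Σ_P N(P) · C(P)`, and the reduction of ★ₖ for a blow-up to the lifted sums of its quotient

Support file (seat `prim-l12-p2` gen 30; `--supports stmt-CriticalPhenomena-4575`; companion of `…SunflowerMultiPetal` (p338110: `MSunflower`, `ZK`,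
`PartitionLemmaK`) and `…SunflowerTracePartition` (prim-ineq-gen-2: `partsOf` block symmetries and the trace decomposition of `parts α`)).  Everything here is
PROVED; no `sorry`, no named facts.  Memo: run/shared/lean/prim/prim-l12/prim-l12-p2/FINDING-g30-HOME-ROUTING.md §5 (Theorem C).

SETTING.  `F : MSunflower k α`.  A MODULE `(M, g)` of `F`: a set `M` of coordinates and a Boolean 'gadget' `g` on the subsets of `M` such that the label of
every set `X` depends on `X ∩ M` only through `g (X ∩ M)`: `F.lab X = F.lab ((X \ M) ∪ (if g (X ∩ M) then M else ∅))` (`IsModule`).  Examples: a block of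
OR-twins (`g S = (S ≠ ∅)`), an AND-block / atom (`g S = (S = M)`), a dummy coordinate, every gadget of a composed instance `λ ∘ (g₁, …, g_m)` (co-stars,
atom joins, threshold stars, the doubled star …).  GLUED SUMS (`gsum W G₀ G₁ G₂`): the partition functional summed over the ordered 3-partitions
`(r₀, r₁, r₂)` of a window `W`, the three blocks being enlarged by fixed 'glue' sets `G₀, G₁, G₂` before labelling; `ZK = gsum univ ∅ ∅ ∅` (`ZK_eq_gsum`).

THE IDENTITY (`gsum_eq_sum_pattern`, this work).  For a module `(M, g)` with `M ⊆ W` and glue sets disjoint from `M`, grouping the partitions of `W` by their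
trace `s` on `M` (the trace decomposition of prim-ineq-gen-2, re-proved here inside a window: `sum_partsOf_eq_sum_traces`, `sum_partsOf_trace_eq`) and using
the module property (the summand depends on `s` only through the FIRING PATTERN `pat M g s ⊆ {0,1,2}` = the blocks of `s` on which `g` fires):
    `gsum W G₀ G₁ G₂ = Σ_{P ⊆ Fin 3} N(P) · gsum (W \ M) (G₀ ∪ [0∈P]M) (G₁ ∪ [1∈P]M) (G₂ ∪ [2∈P]M)`,   `N(P) = #{s ∈ partsOf M : pat M g s = P}`.
So the module is replaced by ONE glued point sitting in the blocks `P`, weighted by the gadget statistics `N(P) ≥ 0`; the identity can be iterated over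
disjoint modules (the glue sets accumulate).  In particular (`ZK_eq_sum_pattern`) `ZK = Σ_P N(P) · C(P)` with the eight LIFTED SUMS
`C(P) = gsum Mᶜ ([0∈P]M) ([1∈P]M) ([2∈P]M)` of the quotient: `C(∅)`, `C({0,1,2})` are the partition functionals of the two sections, `C({j})` is one third
of `ZK` of the quotient, and `C` of a 2-set is the 'point in two blocks' sum of Conjecture G of the memo.  COROLLARY (`ZK_nonneg_of_isModule`): if the eight
lifted sums are nonnegative, ★ₖ holds for the blow-up `F`, whatever the gadget and the size of `M`.  (Memo, Theorem C: iterating over the modules of a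
composed instance, every composition of an instance satisfying Conjecture G with arbitrary monotone gadgets satisfies G and ★ₖ; with the exhaustive
verification of G on ≤ 4 points this covers all co-stars, atom/AND/OR joins and threshold stars on ≤ 4 gadgets, of all sizes.)
-/

namespace Summit.CriticalPhenomena.PercolationContinuityZ3.Theorems.SunflowerPartition

open Finset

variable {α : Type*} [DecidableEq α]

/-! ## Trace decomposition of the ordered 3-partitions of a window `W` along a subset `M ⊆ W` -/

/-- A subset of `W \ M` is disjoint from `M`. [folklore] -/
theorem disjoint_of_subset_sdiff' {r M W : Finset α} (hr : r ⊆ W \ M) : Disjoint r M :=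
  Finset.disjoint_left.2 fun _ hx hxM => (mem_sdiff.1 (hr hx)).2 hxM

/-- The ordered 3-partitions of `W`, regrouped by the traces of their first two blocks on `M`. [this work] -/
theorem sum_partsOf_eq_sum_traces (W M : Finset α) (f : Finset α × Finset α → ℤ) :
    ∑ q ∈ partsOf W, f q = ∑ s ∈ partsOf M, ∑ q ∈ (partsOf W).filter (fun q => q.1 ∩ M = s.1 ∧ q.2 ∩ M = s.2), f q := by
  rw [← sum_fiberwise_of_maps_to (s := partsOf W) (t := partsOf M) (g := fun q => (q.1 ∩ M, q.2 ∩ M))]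
  · refine sum_congr rfl fun s _ => sum_congr ?_ fun _ _ => rfl
    ext q
    simp only [mem_filter, Prod.ext_iff]
  · intro q hq
    rw [Sunflower.mem_partsOf_iff] at hq ⊢
    exact ⟨inter_subset_right, inter_subset_right, hq.2.2.mono inter_subset_left inter_subset_left⟩

/-- **Transfer** inside a window: for `M ⊆ W` and a trace `s ∈ partsOf M`, the ordered 3-partitions of `W` with traces `s` correspond to the ordered
3-partitions `r` of `W \ M` via `(r.1 ∪ s.1, r.2 ∪ s.2)`, the third block being `((W \ M) \ (r.1 ∪ r.2)) ∪ (M \ (s.1 ∪ s.2))`. [this work] -/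
theorem sum_partsOf_trace_eq (W M : Finset α) (hMW : M ⊆ W) {s : Finset α × Finset α} (hs : s ∈ partsOf M)
    (g : Finset α → Finset α → Finset α → ℤ) :
    ∑ q ∈ (partsOf W).filter (fun q => q.1 ∩ M = s.1 ∧ q.2 ∩ M = s.2), g q.1 q.2 (W \ (q.1 ∪ q.2))
      = ∑ r ∈ partsOf (W \ M), g (r.1 ∪ s.1) (r.2 ∪ s.2) (((W \ M) \ (r.1 ∪ r.2)) ∪ (M \ (s.1 ∪ s.2))) := by
  rw [Sunflower.mem_partsOf_iff] at hs
  obtain ⟨hs1, hs2, hsd⟩ := hs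
  refine sum_nbij' (fun q => (q.1 \ M, q.2 \ M)) (fun r => (r.1 ∪ s.1, r.2 ∪ s.2)) ?_ ?_ ?_ ?_ ?_
  · intro q hq
    rw [mem_filter, Sunflower.mem_partsOf_iff] at hq
    obtain ⟨⟨hq1, hq2, hqd⟩, -, -⟩ := hq
    rw [Sunflower.mem_partsOf_iff]
    exact ⟨sdiff_subset_sdiff hq1 (Subset.refl M), sdiff_subset_sdiff hq2 (Subset.refl M), hqd.mono sdiff_subset sdiff_subset⟩
  · intro r hr
    rw [Sunflower.mem_partsOf_iff] at hr
    obtain ⟨hr1, hr2, hrd⟩ := hr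
    have d1 : Disjoint r.1 M := disjoint_of_subset_sdiff' hr1
    have d2 : Disjoint r.2 M := disjoint_of_subset_sdiff' hr2
    rw [mem_filter, Sunflower.mem_partsOf_iff]
    refine ⟨⟨?_, ?_, ?_⟩, ?_, ?_⟩
    · exact union_subset ((hr1.trans sdiff_subset)) (hs1.trans hMW)
    · exact union_subset ((hr2.trans sdiff_subset)) (hs2.trans hMW)
    · rw [disjoint_union_left, disjoint_union_right, disjoint_union_right]
      exact ⟨⟨hrd, d1.mono_right hs2⟩, ⟨(d2.mono_right hs1).symm, hsd⟩⟩
    · rw [union_inter_distrib_right, disjoint_iff_inter_eq_empty.1 d1, empty_union, inter_eq_left.2 hs1]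
    · rw [union_inter_distrib_right, disjoint_iff_inter_eq_empty.1 d2, empty_union, inter_eq_left.2 hs2]
  · intro q hq
    rw [mem_filter] at hq
    obtain ⟨_, h1, h2⟩ := hq
    ext <;> simp only []
    · rw [← h1, sdiff_union_inter]
    · rw [← h2, sdiff_union_inter]
  · intro r hr
    rw [Sunflower.mem_partsOf_iff] at hr
    obtain ⟨hr1, hr2, _⟩ := hr
    have e1 : (r.1 ∪ s.1) \ M = r.1 := by
      rw [union_sdiff_distrib, sdiff_eq_empty_iff_subset.2 hs1, union_empty]
      exact sdiff_eq_self_of_disjoint (disjoint_of_subset_sdiff' hr1)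
    have e2 : (r.2 ∪ s.2) \ M = r.2 := by
      rw [union_sdiff_distrib, sdiff_eq_empty_iff_subset.2 hs2, union_empty]
      exact sdiff_eq_self_of_disjoint (disjoint_of_subset_sdiff' hr2)
    ext <;> simp only [e1, e2]
  · intro q hq
    rw [mem_filter, Sunflower.mem_partsOf_iff] at hq
    obtain ⟨⟨hq1, hq2, -⟩, h1, h2⟩ := hq
    have e1 : q.1 \ M ∪ s.1 = q.1 := by rw [← h1, sdiff_union_inter]
    have e2 : q.2 \ M ∪ s.2 = q.2 := by rw [← h2, sdiff_union_inter]
    rw [e1, e2, ← h1, ← h2]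
    congr 1
    ext x
    have hx1 : x ∈ q.1 → x ∈ W := fun h => hq1 h
    have hx2 : x ∈ q.2 → x ∈ W := fun h => hq2 h
    have hxM : x ∈ M → x ∈ W := fun h => hMW h
    simp only [mem_union, mem_sdiff, mem_inter]
    tauto

namespace MSunflower

variable {k : ℕ} (F : MSunflower k α)

/-- `(M, g)` is a MODULE of `F`: the label of `X` depends on `X ∩ M` only through the Boolean gadget value `g (X ∩ M)`. [this work] -/
def IsModule (M : Finset α) (g : Finset α → Bool) : Prop :=
  ∀ X : Finset α, F.lab X = F.lab ((X \ M) ∪ (if g (X ∩ M) then M else ∅))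

/-- GLUED partition sum over a window `W`: the blocks of the ordered 3-partitions of `W` are enlarged by the glue sets `G₀, G₁, G₂` before labelling. [this work] -/
def gsum (W G₀ G₁ G₂ : Finset α) : ℤ :=
  ∑ r ∈ partsOf W, s6K k (F.lab (r.1 ∪ G₀)) (F.lab (r.2 ∪ G₁)) (F.lab ((W \ (r.1 ∪ r.2)) ∪ G₂))

/-- `ZK` is the unglued sum over the whole ground set. [this work] -/
theorem ZK_eq_gsum [Fintype α] : F.ZK = F.gsum univ ∅ ∅ ∅ := by
  unfold ZK gsum
  rw [partsOf_univ]
  refine sum_congr rfl fun q _ => ?_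
  rw [union_empty, union_empty, union_empty, compl_eq_univ_sdiff]

/-- The firing pattern of the gadget `g` on a trace `s = (s.1, s.2, M ∖ (s.1 ∪ s.2))`: the set of blocks on which `g` fires. [this work] -/
def pat (M : Finset α) (g : Finset α → Bool) (s : Finset α × Finset α) : Finset (Fin 3) :=
  (univ : Finset (Fin 3)).filter fun j =>
    (j = 0 ∧ g s.1 = true) ∨ (j = 1 ∧ g s.2 = true) ∨ (j = 2 ∧ g (M \ (s.1 ∪ s.2)) = true)

/-- The glue contributed by the module when it sits in the blocks listed in `P`: `M` for `j ∈ P`, nothing otherwise. [this work] -/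
def glue (M : Finset α) (P : Finset (Fin 3)) (j : Fin 3) : Finset α := if j ∈ P then M else ∅

variable {F}

/-- Under the module property, the label of a block `r ∪ s ∪ G` (`r, G` disjoint from `M`, `s ⊆ M`) is the label of `r ∪ G` with `M` glued iff `g s`. [this work] -/
theorem lab_union_trace {M : Finset α} {g : Finset α → Bool} (hF : F.IsModule M g) {r s G : Finset α}
    (hr : Disjoint r M) (hs : s ⊆ M) (hG : Disjoint G M) :
    F.lab (r ∪ s ∪ G) = F.lab (r ∪ G ∪ (if g s then M else ∅)) := by
  have h1 : (r ∪ s ∪ G) \ M = r ∪ G := by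
    rw [union_sdiff_distrib, union_sdiff_distrib, sdiff_eq_empty_iff_subset.2 hs, union_empty,
      sdiff_eq_self_of_disjoint hr, sdiff_eq_self_of_disjoint hG]
  have h2 : (r ∪ s ∪ G) ∩ M = s := by
    rw [union_inter_distrib_right, union_inter_distrib_right, inter_eq_left.2 hs,
      disjoint_iff_inter_eq_empty.1 hr, disjoint_iff_inter_eq_empty.1 hG, empty_union, union_empty]
  rw [hF (r ∪ s ∪ G), h1, h2]

variable (F)

/-- **The module identity for glued sums**: the module `M ⊆ W` is replaced by one glued point sitting in the blocks `P`, weighted by the gadget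
statistics `N(P) = #{s ∈ partsOf M : pat M g s = P}`. [this work] -/
theorem gsum_eq_sum_pattern {M : Finset α} {g : Finset α → Bool} (hF : F.IsModule M g) {W G₀ G₁ G₂ : Finset α}
    (hMW : M ⊆ W) (h0 : Disjoint G₀ M) (h1 : Disjoint G₁ M) (h2 : Disjoint G₂ M) :
    F.gsum W G₀ G₁ G₂ = ∑ P : Finset (Fin 3), (((partsOf M).filter fun s => pat M g s = P).card : ℤ) *
      F.gsum (W \ M) (G₀ ∪ glue M P 0) (G₁ ∪ glue M P 1) (G₂ ∪ glue M P 2) := by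
  unfold gsum
  rw [sum_partsOf_eq_sum_traces W M (fun q => s6K k (F.lab (q.1 ∪ G₀)) (F.lab (q.2 ∪ G₁)) (F.lab ((W \ (q.1 ∪ q.2)) ∪ G₂)))]
  have inner : ∀ s ∈ partsOf M,
      ∑ q ∈ (partsOf W).filter (fun q => q.1 ∩ M = s.1 ∧ q.2 ∩ M = s.2),
          s6K k (F.lab (q.1 ∪ G₀)) (F.lab (q.2 ∪ G₁)) (F.lab ((W \ (q.1 ∪ q.2)) ∪ G₂))
        = ∑ r ∈ partsOf (W \ M), s6K k (F.lab (r.1 ∪ (G₀ ∪ glue M (pat M g s) 0))) (F.lab (r.2 ∪ (G₁ ∪ glue M (pat M g s) 1)))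
            (F.lab (((W \ M) \ (r.1 ∪ r.2)) ∪ (G₂ ∪ glue M (pat M g s) 2))) := by
    intro s hs
    rw [sum_partsOf_trace_eq W M hMW hs (fun X Y Z => s6K k (F.lab (X ∪ G₀)) (F.lab (Y ∪ G₁)) (F.lab (Z ∪ G₂)))]
    obtain ⟨hs1, hs2, -⟩ := (Sunflower.mem_partsOf_iff).1 hs
    have hs3 : M \ (s.1 ∪ s.2) ⊆ M := sdiff_subset
    refine sum_congr rfl fun r hr => ?_
    obtain ⟨hr1, hr2, -⟩ := (Sunflower.mem_partsOf_iff).1 hr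
    have hr3 : (W \ M) \ (r.1 ∪ r.2) ⊆ W \ M := sdiff_subset
    have p0 : ((0 : Fin 3) ∈ pat M g s) = (g s.1 = true) := by unfold pat; simp
    have p1 : ((1 : Fin 3) ∈ pat M g s) = (g s.2 = true) := by unfold pat; simp
    have p2 : ((2 : Fin 3) ∈ pat M g s) = (g (M \ (s.1 ∪ s.2)) = true) := by unfold pat; simp
    rw [F.lab_union_trace hF (disjoint_of_subset_sdiff' hr1) hs1 h0, F.lab_union_trace hF (disjoint_of_subset_sdiff' hr2) hs2 h1,
      F.lab_union_trace hF (disjoint_of_subset_sdiff' hr3) hs3 h2]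
    unfold glue
    simp only [p0, p1, p2, union_assoc]
  rw [sum_congr rfl inner]
  rw [← sum_fiberwise_of_maps_to (s := partsOf M) (t := (univ : Finset (Finset (Fin 3)))) (g := fun s => pat M g s)
    (fun s _ => mem_univ _)]
  refine sum_congr rfl fun P _ => ?_
  rw [sum_congr rfl (fun s hs => by rw [(mem_filter.1 hs).2] :
    ∀ s ∈ (partsOf M).filter (fun s => pat M g s = P),
      (∑ r ∈ partsOf (W \ M), s6K k (F.lab (r.1 ∪ (G₀ ∪ glue M (pat M g s) 0))) (F.lab (r.2 ∪ (G₁ ∪ glue M (pat M g s) 1)))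
          (F.lab (((W \ M) \ (r.1 ∪ r.2)) ∪ (G₂ ∪ glue M (pat M g s) 2))))
        = ∑ r ∈ partsOf (W \ M), s6K k (F.lab (r.1 ∪ (G₀ ∪ glue M P 0))) (F.lab (r.2 ∪ (G₁ ∪ glue M P 1)))
            (F.lab (((W \ M) \ (r.1 ∪ r.2)) ∪ (G₂ ∪ glue M P 2))))]
  rw [sum_const, nsmul_eq_mul]

/-- The eight LIFTED sums of the quotient by the module `M`: the module collapsed to one point placed in the blocks `P`. [this work] -/
def modCoef [Fintype α] (M : Finset α) (P : Finset (Fin 3)) : ℤ := F.gsum Mᶜ (glue M P 0) (glue M P 1) (glue M P 2)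

/-- **`ZK = Σ_P N(P) · C(P)`** for a module `(M, g)`. [this work] -/
theorem ZK_eq_sum_pattern [Fintype α] {M : Finset α} {g : Finset α → Bool} (hF : F.IsModule M g) :
    F.ZK = ∑ P : Finset (Fin 3), (((partsOf M).filter fun s => pat M g s = P).card : ℤ) * F.modCoef M P := by
  rw [F.ZK_eq_gsum, F.gsum_eq_sum_pattern hF (subset_univ M) (disjoint_empty_left M) (disjoint_empty_left M) (disjoint_empty_left M)]
  unfold modCoef
  refine sum_congr rfl fun P _ => ?_
  rw [empty_union, empty_union, empty_union, compl_eq_univ_sdiff]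

/-- **Corollary: ★ₖ for a blow-up from the lifted sums of its quotient.**  If `(M, g)` is a module of `F` and the eight lifted sums `C(P)` are
nonnegative, then `0 ≤ F.ZK`. [this work] -/
theorem ZK_nonneg_of_isModule [Fintype α] {M : Finset α} {g : Finset α → Bool} (hF : F.IsModule M g)
    (hC : ∀ P : Finset (Fin 3), 0 ≤ F.modCoef M P) : 0 ≤ F.ZK := by
  rw [F.ZK_eq_sum_pattern hF]
  exact sum_nonneg fun P _ => mul_nonneg (by exact_mod_cast Nat.zero_le _) (hC P)

/-- **Corollary (iterable form)**: if for a module `M ⊆ W` every glued sum over `W \ M` with the module glued in the blocks `P` is nonnegative, so is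
the glued sum over `W`. [this work] -/
theorem gsum_nonneg_of_isModule {M : Finset α} {g : Finset α → Bool} (hF : F.IsModule M g) {W G₀ G₁ G₂ : Finset α}
    (hMW : M ⊆ W) (h0 : Disjoint G₀ M) (h1 : Disjoint G₁ M) (h2 : Disjoint G₂ M)
    (hC : ∀ P : Finset (Fin 3), 0 ≤ F.gsum (W \ M) (G₀ ∪ glue M P 0) (G₁ ∪ glue M P 1) (G₂ ∪ glue M P 2)) :
    0 ≤ F.gsum W G₀ G₁ G₂ := by
  rw [F.gsum_eq_sum_pattern hF hMW h0 h1 h2]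
  exact sum_nonneg fun P _ => mul_nonneg (by exact_mod_cast Nat.zero_le _) (hC P)


/-! ## Iterating the identity: glue only, and the full expansion of `ZK` along three modules covering the ground set -/

/-- Over the empty window the glued sum is the single kernel value of the glue sets. [this work] -/
theorem gsum_empty (G₀ G₁ G₂ : Finset α) : F.gsum ∅ G₀ G₁ G₂ = s6K k (F.lab G₀) (F.lab G₁) (F.lab G₂) := by
  unfold gsum
  rw [partsOf_empty, sum_singleton]
  simp only [empty_union, sdiff_empty, union_empty]

omit [DecidableEq α] in
/-- The glue of a module is disjoint from every set disjoint from the module. [this work] -/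
theorem disjoint_glue [DecidableEq α] {M M' : Finset α} (h : Disjoint M M') (P : Finset (Fin 3)) (j : Fin 3) :
    Disjoint (glue M P j) M' := by
  unfold glue
  split_ifs
  · exact h
  · exact disjoint_empty_left M'

/-- The gadget statistics of a module: the number of traces on `M` with firing pattern `P`. [this work] -/
def patCount (M : Finset α) (g : Finset α → Bool) (P : Finset (Fin 3)) : ℤ :=
  (((partsOf M).filter fun s => pat M g s = P).card : ℤ)

/-- `patCount` is nonnegative. [this work] -/
theorem patCount_nonneg (M : Finset α) (g : Finset α → Bool) (P : Finset (Fin 3)) : 0 ≤ patCount M g P := by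
  unfold patCount
  exact_mod_cast Nat.zero_le _

/-- **Full expansion along three modules covering the ground set** (the composition `λ ∘ (g₁, g₂, g₃)` of a 3-point structure `λ` with three gadgets):
`ZK = Σ_{P₁,P₂,P₃} N₁(P₁) N₂(P₂) N₃(P₃) · s6K` of the labels of the three glued unions `⋃ {M_i : j ∈ P_i}` (`j = 0,1,2`) — the partition functional of the blow-up
is a trilinear form in the gadget statistics whose coefficients are kernel values of the quotient. [this work] -/
theorem ZK_eq_sum_three_modules [Fintype α] {M₁ M₂ M₃ : Finset α} {g₁ g₂ g₃ : Finset α → Bool}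
    (h₁ : F.IsModule M₁ g₁) (h₂ : F.IsModule M₂ g₂) (h₃ : F.IsModule M₃ g₃)
    (d₁₂ : Disjoint M₁ M₂) (d₁₃ : Disjoint M₁ M₃) (d₂₃ : Disjoint M₂ M₃) (hcov : M₁ ∪ M₂ ∪ M₃ = univ) :
    F.ZK = ∑ P₁ : Finset (Fin 3), patCount M₁ g₁ P₁ * ∑ P₂ : Finset (Fin 3), patCount M₂ g₂ P₂ * ∑ P₃ : Finset (Fin 3), patCount M₃ g₃ P₃ *
      s6K k (F.lab (glue M₁ P₁ 0 ∪ glue M₂ P₂ 0 ∪ glue M₃ P₃ 0)) (F.lab (glue M₁ P₁ 1 ∪ glue M₂ P₂ 1 ∪ glue M₃ P₃ 1))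
        (F.lab (glue M₁ P₁ 2 ∪ glue M₂ P₂ 2 ∪ glue M₃ P₃ 2)) := by
  have hM₂ : M₂ ⊆ univ \ M₁ := by
    intro x hx
    exact mem_sdiff.2 ⟨mem_univ _, fun h1 => Finset.disjoint_left.1 d₁₂ h1 hx⟩
  have hM₃ : M₃ ⊆ (univ \ M₁) \ M₂ := by
    intro x hx
    exact mem_sdiff.2 ⟨mem_sdiff.2 ⟨mem_univ _, fun h1 => Finset.disjoint_left.1 d₁₃ h1 hx⟩,
      fun h2 => Finset.disjoint_left.1 d₂₃ h2 hx⟩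
  have hempty : ((univ \ M₁) \ M₂) \ M₃ = ∅ := by
    ext x
    have hx : x ∈ M₁ ∪ M₂ ∪ M₃ := by rw [hcov]; exact mem_univ _
    simp only [mem_sdiff, mem_univ, true_and, Finset.notMem_empty, iff_false, not_and, not_not]
    intro hx12
    rcases mem_union.1 hx with h | h
    · rcases mem_union.1 h with h | h
      · exact absurd h hx12.1
      · exact absurd h hx12.2
    · exact h
  rw [F.ZK_eq_gsum, F.gsum_eq_sum_pattern h₁ (subset_univ M₁) (disjoint_empty_left M₁) (disjoint_empty_left M₁) (disjoint_empty_left M₁)]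
  unfold patCount
  refine sum_congr rfl fun P₁ _ => ?_
  congr 1
  rw [empty_union, empty_union, empty_union,
    F.gsum_eq_sum_pattern h₂ hM₂ (disjoint_glue d₁₂ P₁ 0) (disjoint_glue d₁₂ P₁ 1) (disjoint_glue d₁₂ P₁ 2)]
  refine sum_congr rfl fun P₂ _ => ?_
  congr 1
  rw [F.gsum_eq_sum_pattern h₃ hM₃
      (disjoint_union_left.2 ⟨disjoint_glue d₁₃ P₁ 0, disjoint_glue d₂₃ P₂ 0⟩)
      (disjoint_union_left.2 ⟨disjoint_glue d₁₃ P₁ 1, disjoint_glue d₂₃ P₂ 1⟩)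
      (disjoint_union_left.2 ⟨disjoint_glue d₁₃ P₁ 2, disjoint_glue d₂₃ P₂ 2⟩)]
  refine sum_congr rfl fun P₃ _ => ?_
  congr 1
  rw [hempty, F.gsum_empty]

/-- **Corollary**: if, for a blow-up of a 3-point structure, the trilinear form has been shown nonnegative (e.g. by grouping the patterns by size
and checking the finitely many grouped coefficients of the quotient), then ★ₖ holds — recorded as the shape in which such verifications are used.
Here the trivial sufficient condition: every kernel value of the glued unions is nonnegative. [this work] -/
theorem ZK_nonneg_of_three_modules_pointwise [Fintype α] {M₁ M₂ M₃ : Finset α} {g₁ g₂ g₃ : Finset α → Bool}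
    (h₁ : F.IsModule M₁ g₁) (h₂ : F.IsModule M₂ g₂) (h₃ : F.IsModule M₃ g₃)
    (d₁₂ : Disjoint M₁ M₂) (d₁₃ : Disjoint M₁ M₃) (d₂₃ : Disjoint M₂ M₃) (hcov : M₁ ∪ M₂ ∪ M₃ = univ)
    (hv : ∀ P₁ P₂ P₃ : Finset (Fin 3), patCount M₁ g₁ P₁ ≠ 0 → patCount M₂ g₂ P₂ ≠ 0 → patCount M₃ g₃ P₃ ≠ 0 →
      0 ≤ s6K k (F.lab (glue M₁ P₁ 0 ∪ glue M₂ P₂ 0 ∪ glue M₃ P₃ 0)) (F.lab (glue M₁ P₁ 1 ∪ glue M₂ P₂ 1 ∪ glue M₃ P₃ 1))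
        (F.lab (glue M₁ P₁ 2 ∪ glue M₂ P₂ 2 ∪ glue M₃ P₃ 2))) :
    0 ≤ F.ZK := by
  rw [F.ZK_eq_sum_three_modules h₁ h₂ h₃ d₁₂ d₁₃ d₂₃ hcov]
  refine sum_nonneg fun P₁ _ => ?_
  by_cases hP₁ : patCount M₁ g₁ P₁ = 0
  · rw [hP₁, zero_mul]
  refine mul_nonneg (patCount_nonneg _ _ _) (sum_nonneg fun P₂ _ => ?_)
  by_cases hP₂ : patCount M₂ g₂ P₂ = 0
  · rw [hP₂, zero_mul]
  refine mul_nonneg (patCount_nonneg _ _ _) (sum_nonneg fun P₃ _ => ?_)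
  by_cases hP₃ : patCount M₃ g₃ P₃ = 0
  · rw [hP₃, zero_mul]
  exact mul_nonneg (patCount_nonneg _ _ _) (hv P₁ P₂ P₃ hP₁ hP₂ hP₃)

end MSunflower

end Summit.CriticalPhenomena.PercolationContinuityZ3.Theorems.SunflowerPartition
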